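import Mathlib
import Summits.NavierStokesRegularity.NavierStokesRegularity.Theorems.TaoLadderRungTwoBreakOneShiftWindowCentreStepD
import HarnessLib

/-!
# The one-shift window system, LV: THE POINT-TIME C¹ ENCLOSURE OF THE CENTRE STEP — `CentreStepD.endMatI TI` =
# `Σ_{j<K} TI^j ⊗ Φ′_j(W) ⊕ TI^K ⊗ NN` and `CentreStepD.soundE` (part XXVIII `sound` with a fourth clause: at any
# time `τ ∈ TI ⊆ [0, h]` the flow derivative within the start box has its entries in `endMatI TI`)
# (cell harvest/h2-tao-ladder, seat p2; rung1/KERNEL-CHEAP-REPLAY-SPEC.md §2 (e)/(g), §10; support for K1(1) =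
# `NoSurvivingDSSOne`, stmt-NavierStokesRegularity-20205)

WHY (finding of the emitter, p2 g15): the C¹ box `VV` of part XXVIII must contain the flow derivative for EVERY
`τ ∈ [0, h]` (it is tested against `Σ_j [0,h]^j ⊗ Φ′_j ⊕ [0,h]^K ⊗ NN`), so it contains the identity (τ = 0) AND
the end-of-step Jacobian: an interval of width `≈ h‖Df‖` per entry. Part XXXIX's product chain `V_{s+1} ⊇
(VV_s ± Ẑ₂) ⊗ V_s` therefore accumulates a relative width `Σ_s h_s‖Df‖` (≈ 3.6 on the T4W76 flight: useless for a
Krawczyk test at the 10⁻³ level), independently of the step size. The cure is the classical one [Moore 1979 §8.1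
(8.13) at `t = t₁`; Nedialkov–Jackson–Pryce 2001 §3]: at the END of the step use the Taylor form AT THE POINT TIME,
`DΦ_h(x) = Σ_{j<K} h^j Φ′_j(x) + h^K N`, `N ∈ NN` — exactly the fourth output of the Literature theorem
`hasFDerivWithinAt_flow_of_variationalEnclosure_smoothOn_local`, which part XXVIII discarded. `endMatI` evaluates that
form with a time box `TI ∋ τ` (a point box `[h, h]` for a regular step; a thin box for an interval end time) from the
SAME jet tables as `check`; its width is the second-order variation over the start box (≈ 10⁻¹⁰ on T4W76), not `h‖Df‖`.
Parts LVI–LVIII rebuild the pair slope, the product Boolean and the grid glue on it.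

MODEL lattice ODEs only (Tao 2016 §4 normal form on Tao's shift set `S`); nothing here is a statement about the
Navier–Stokes equations; no item is closed; no instance is evaluated here. Generic in `ι`, `κ`.
-/

-- the sub-problem namespace repeats the summit name by design (D-0017)
set_option linter.dupNamespace false

namespace Summit.NavierStokesRegularity.NavierStokesRegularity.Theorems

namespace DSSOneShift

open Set Finset Metric TopologicalSpace
open Literature.Analysis.ODE
open Summit.NavierStokesRegularity.NavierStokesRegularity.Theorems.TaylorModelCert
open Summit.NavierStokesRegularity.NavierStokesRegularity.Theorems.TaylorModelReadout
open Summit.NavierStokesRegularity.NavierStokesRegularity.Theorems.CertificateGlueOn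
open scoped ContDiff

namespace CentreStepD

variable (d : CentreStepD)

/-- **The point-time C¹ enclosure** `endMatI TI (i,l) = Σ_{j<K} TI^j ⊗ Φ′_j(W)_{il} ⊕ TI^K ⊗ NN_{il}` from the
variational jet tables of the centre test (`vars (jets W)`, `nnA (vars (jets S))`), for a time box `TI`.
[cite: Moore1979, §8.1 eq. (8.13) (at t = t₁); NedialkovJacksonPryce2001, §3; WalawskaWilczak2016, §2.2 Lemma 2] -/
def endMatI (TI : IntervalD) (i l : ℕ) : IntervalD :=
  IntervalD.addR d.prec
    (IntervalD.rangeSumR d.prec (fun j => IntervalD.mulR d.prec (IntervalD.powR d.prec TI j)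
      (d.ev (d.vars (d.jets d.W)) j i l)) d.K)
    (IntervalD.mulR d.prec (IntervalD.powR d.prec TI d.K) (IntervalD.aget (d.nnA (d.vars (d.jets d.S))) (l * d.n + i)))

/-- **The point-time C¹ enclosure, MATERIALISED** (column-major `n × n`, entry `(i,l)` at `l·n + i`; the jet tables
are computed ONCE — the form the product Boolean of part LVII evaluates). [cite: Moore1979, §8.1 eq. (8.13); NedialkovJacksonPryce2001, §3] -/
def endMatA (TI : IntervalD) : Array IntervalD :=
  let VW := d.vars (d.jets d.W)
  let NN := d.nnA (d.vars (d.jets d.S))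
  let pw : Array IntervalD := Array.ofFn fun j : Fin (d.K + 1) => IntervalD.powR d.prec TI j
  Array.ofFn fun t : Fin (d.n * d.n) =>
    IntervalD.addR d.prec
      (IntervalD.rangeSumR d.prec (fun j => IntervalD.mulR d.prec (IntervalD.aget pw j)
        (d.ev VW j (t.val % d.n) (t.val / d.n))) d.K)
      (IntervalD.mulR d.prec (IntervalD.aget pw d.K) (IntervalD.aget NN t.val))

/-- The materialised table agrees with `endMatI`. [folklore] -/
theorem aget_endMatA (TI : IntervalD) {i l : ℕ} (hi : i < d.n) (hl : l < d.n) :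
    IntervalD.aget (d.endMatA TI) (l * d.n + i) = d.endMatI TI i l := by
  have hflat : l * d.n + i < d.n * d.n ∧ (l * d.n + i) / d.n = l ∧ (l * d.n + i) % d.n = i :=
    ⟨by nlinarith [Nat.mul_le_mul_right d.n (Nat.succ_le_of_lt hl), hi],
      by rw [add_comm, Nat.add_mul_div_right _ _ (Nat.zero_lt_of_lt hi), Nat.div_eq_of_lt hi, zero_add],
      by rw [add_comm, Nat.add_mul_mod_self_right, Nat.mod_eq_of_lt hi]⟩
  obtain ⟨h1, h2, h3⟩ := hflat
  unfold endMatA endMatI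
  simp only []
  rw [IntervalD.aget_ofFn _ h1]
  dsimp only
  rw [h2, h3]
  have hpw : ∀ j ≤ d.K, IntervalD.aget (Array.ofFn fun j : Fin (d.K + 1) => IntervalD.powR d.prec TI j) j =
      IntervalD.powR d.prec TI j := fun j hj => by
    rw [IntervalD.aget_ofFn _ (Nat.lt_succ_of_le hj)]
  rw [hpw d.K le_rfl]
  congr 1
  exact IntervalD.rangeSumR_congr d.prec d.K fun j hj => by rw [hpw j (le_of_lt hj)]

section Sound

variable {ι : Type*} [Fintype ι] [DecidableEq ι] {κ : Type*} [Fintype κ]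

/-- **SOUNDNESS OF THE CENTRE-STEP TEST, WITH THE POINT-TIME C¹ FORM** (part XXVIII `sound` verbatim plus the
fourth clause). [cite: WalawskaWilczak2016, §2.1 and §2.2 Lemma 2; Moore1979, §8.1 eqs. (8.10), (8.13); NedialkovJacksonPryce2001, §3] -/
theorem soundE (T : κ → BTerm ι) (e : ι ≃ Fin d.n) (hSD : IsSQEnclosure (homQ T e) d.SD) (hc : d.check = true) :
    ∃ uc : (ι → ℝ) → ℝ → ι → ℝ,
      IsSolutionFamily (termField T) (boxSet (boxOf e d.S)) (boxSet (boxOf e d.W)) d.hD.toReal uc ∧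
      (∀ z : ℝ → ι → ℝ, z 0 ∈ boxSet (boxOf e d.W) →
        (∀ t ∈ Icc 0 d.hD.toReal, HasDerivWithinAt z (termField T (z t)) (Icc 0 d.hD.toReal) t) →
        ∀ t ∈ Icc 0 d.hD.toReal, z t ∈ boxSet (boxOf e d.S)) ∧
      (∀ x ∈ boxSet (boxOf e d.W), ∀ τ ∈ Icc 0 d.hD.toReal, ∃ J : (ι → ℝ) →L[ℝ] (ι → ℝ),
        HasFDerivWithinAt (fun x' => uc x' τ) J (boxSet (boxOf e d.W)) x ∧
        ∀ i l, (d.vv (e i) (e l)).lo.toReal ≤ J (Pi.single l 1) i ∧ J (Pi.single l 1) i ≤ (d.vv (e i) (e l)).hi.toReal) ∧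
      (∀ x ∈ boxSet (boxOf e d.W), ∀ τ ∈ Icc 0 d.hD.toReal, ∀ TI : IntervalD, IntervalD.mem τ TI →
        ∃ J : (ι → ℝ) →L[ℝ] (ι → ℝ),
        HasFDerivWithinAt (fun x' => uc x' τ) J (boxSet (boxOf e d.W)) x ∧
        ∀ i l, IntervalD.mem (J (Pi.single l 1) i) (d.endMatI TI (e i) (e l))) := by
  classical
  -- names
  set JW := d.jets d.W with hJW
  set JS := d.jets d.S with hJS
  set VW := d.vars JW with hVW
  set VS := d.vars JS with hVS
  set NN := d.nnA VS with hNN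
  rw [check_eq] at hc
  obtain ⟨hK, hh, hcS, hcM⟩ := d.of_checkWith hc
  set h := d.hD.toReal with hhdef
  set Wr := boxOf e d.W with hWr
  set Sr := boxOf e d.S with hSr
  have hwfW : ∀ c < d.n, wfD (IntervalD.aget d.W c) = true := fun c hc => (hcS c hc).1
  have hwfS : ∀ c < d.n, wfD (IntervalD.aget d.S c) = true := fun c hc => wfD_of_wfsD (hcS c hc).2.1
  -- the field and its Taylor data
  have hf : ContDiff ℝ ∞ (termField T) := (contDiff_termField T).of_le le_top
  have hfOn : ContDiffOn ℝ ∞ (termField T) ((⊤ : Opens (ι → ℝ)) : Set (ι → ℝ)) := termField_contDiffOn T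
  have ePhi : ∀ j, smoothTaylorMap (Ω := ⊤) hfOn j = tjet T j := fun j => rfl
  have ePhi' : ∀ j x v, smoothTaylorFDeriv (Ω := ⊤) hfOn j x v = vjet T j x v := fun j x v => rfl
  -- (F3) state jets over W and S
  have hjetW : ∀ x ∈ boxSet Wr, ∀ j ≤ d.K, ∀ i, IntervalD.mem (tjet T j x i) (IntervalD.aget (IntervalD.lget JW j) (e i)) := by
    intro x hx j hj i
    have hm : IntervalD.mem (tjet T j x (e.symm ⟨(e i : ℕ), (e i).isLt⟩)) (IntervalD.aget (IntervalD.lget JW j) (e i)) :=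
      mem_tjet_of_jetLevelsA T e hSD d.prec d.K (d.size_ext d.W) (d.hboxMem_of_mem_boxOf e hwfW hx) hj (e i).isLt
    simpa using hm
  have hjetS : ∀ z ∈ boxSet Sr, ∀ j ≤ d.K, ∀ i, IntervalD.mem (tjet T j z i) (IntervalD.aget (IntervalD.lget JS j) (e i)) := by
    intro z hz j hj i
    have hm : IntervalD.mem (tjet T j z (e.symm ⟨(e i : ℕ), (e i).isLt⟩)) (IntervalD.aget (IntervalD.lget JS j) (e i)) :=
      mem_tjet_of_jetLevelsA T e hSD d.prec d.K (d.size_ext d.S) (d.hboxMem_of_mem_boxOf e hwfS hz) hj (e i).isLt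
    simpa using hm
  -- (F4) variational jets over W and S
  have hvarW : ∀ x ∈ boxSet Wr, ∀ j ≤ d.K, ∀ i l, IntervalD.mem (vjet T j x (Pi.single l 1) i) (d.ev VW j (e i) (e l)) := by
    intro x hx j hj i l
    exact mem_vjet_single_of_varMatLevelsA T e hSD d.prec d.K
      (mem_hjet_of_jetLevelsA T e hSD d.prec d.K (d.size_ext d.W) (d.hboxMem_of_mem_boxOf e hwfW hx)) hj i l
  have hvarS : ∀ z ∈ boxSet Sr, ∀ j ≤ d.K, ∀ i l, IntervalD.mem (vjet T j z (Pi.single l 1) i) (d.ev VS j (e i) (e l)) := by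
    intro z hz j hj i l
    exact mem_vjet_single_of_varMatLevelsA T e hSD d.prec d.K
      (mem_hjet_of_jetLevelsA T e hSD d.prec d.K (d.size_ext d.S) (d.hboxMem_of_mem_boxOf e hwfS hz)) hj i l
  -- the remainder boxes
  set c : ι → ℝ := fun i => (IntervalD.aget (IntervalD.lget JS d.K) (e i)).lo.toReal with hcdef
  set dd : ι → ℝ := fun i => (IntervalD.aget (IntervalD.lget JS d.K) (e i)).hi.toReal with hdddef
  have hKS : MapsTo (smoothTaylorMap (Ω := ⊤) hfOn d.K) (boxSet Sr) (Icc c dd) := by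
    intro z hz
    rw [ePhi]
    exact ⟨fun i => (hjetS z hz d.K le_rfl i).1, fun i => (hjetS z hz d.K le_rfl i).2⟩
  have hSne : boxLo Sr ∈ boxSet Sr := left_mem_Icc.2 (boxLo_le_boxHi Sr)
  have hcd : c ≤ dd := by
    have hz := hKS hSne
    exact fun i => (hz.1 i).trans (hz.2 i)
  -- hincl
  have hincl : ∀ y₀ ∈ boxSet Wr, ∀ t ∈ Icc 0 h, ∀ v ∈ Icc c dd,
      (∑ j ∈ Finset.range d.K, t ^ j • smoothTaylorMap (Ω := ⊤) hfOn j y₀) + t ^ d.K • v ∈ boxSet Sr := by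
    intro y₀ hy₀ t ht v hv
    rw [mem_boxSet_iff]
    intro i
    refine mem_toNI (IntervalD.mem_of_subset (hcS (e i) (e i).isLt).2.2 ?_)
    simp only [Pi.add_apply, Finset.sum_apply, Pi.smul_apply, smul_eq_mul, ePhi]
    refine IntervalD.mem_addR d.prec (IntervalD.mem_rangeSumR d.prec d.K fun j hj => ?_) ?_
    · exact IntervalD.mem_mulR d.prec (d.mem_pows ht (le_of_lt hj)) (hjetW y₀ hy₀ j (le_of_lt hj) i)
    · exact IntervalD.mem_mulR d.prec (d.mem_pows ht le_rfl) ⟨hv.1 i, hv.2 i⟩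
  -- (i) existence and enclosure from the C⁰ theorem
  have hC0 : ∀ y₀ ∈ boxSet Wr,
      (∃ y : ℝ → ι → ℝ, y 0 = y₀ ∧ ∀ t ∈ Icc 0 h, HasDerivWithinAt y (termField T (y t)) (Icc 0 h) t) ∧
      ∀ z : ℝ → ι → ℝ, z 0 = y₀ → (∀ t ∈ Icc 0 h, HasDerivWithinAt z (termField T (z t)) (Icc 0 h) t) →
        ∀ t ∈ Icc 0 h, z t ∈ boxSet Sr := by
    intro y₀ hy₀
    have H := highOrderEnclosure_step_smooth hf hK (S := boxSet Sr) (W := boxSet Wr) (isBounded_boxSet Sr)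
      (convex_boxSet Sr) hcd hKS hh hincl hy₀
    exact ⟨H.1, fun z hz0 hz t ht => (H.2 z hz0 hz t ht).1⟩
  -- the centre family
  let uc : (ι → ℝ) → ℝ → ι → ℝ := fun y₀ => if hy : y₀ ∈ boxSet Wr then Classical.choose (hC0 y₀ hy).1 else fun _ => y₀
  have huc_spec : ∀ y₀ (hy : y₀ ∈ boxSet Wr), uc y₀ 0 = y₀ ∧
      ∀ t ∈ Icc 0 h, HasDerivWithinAt (uc y₀) (termField T (uc y₀ t)) (Icc 0 h) t := by
    intro y₀ hy
    have e1 : uc y₀ = Classical.choose (hC0 y₀ hy).1 := dif_pos hy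
    rw [e1]
    exact Classical.choose_spec (hC0 y₀ hy).1
  have hu : IsSolutionFamily (termField T) (boxSet Sr) (boxSet Wr) h uc :=
    { init := fun y hy => (huc_spec y hy).1
      hasDerivWithinAt := fun y hy => (huc_spec y hy).2
      mem := fun y hy t ht => (hC0 y hy).2 (uc y) (huc_spec y hy).1 (huc_spec y hy).2 t ht }
  -- the C¹ data
  set CV : ι → ι → ℝ := fun i l => (d.vv (e i) (e l)).lo.toReal with hCV
  set DV : ι → ι → ℝ := fun i l => (d.vv (e i) (e l)).hi.toReal with hDV
  set CN : ι → ι → ℝ := fun i l => (IntervalD.aget NN ((e l : ℕ) * d.n + (e i : ℕ))).lo.toReal with hCN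
  set DN : ι → ι → ℝ := fun i l => (IntervalD.aget NN ((e l : ℕ) * d.n + (e i : ℕ))).hi.toReal with hDN
  have hCDN : CN ≤ DN := fun i l => (Dyad.ble_iff _ _).1 (hcM (e i) (e i).isLt (e l) (e l).isLt).2.1
  -- NN entries enclose (DΦ_K(z) ∘ M) for z ∈ S, M ∈ [CV, DV]
  have hNNmem : ∀ z ∈ boxSet Sr, ∀ M : (ι → ℝ) →L[ℝ] (ι → ℝ),
      (fun i j => M (Pi.single j 1) i) ∈ Icc CV DV → ∀ i l,
      IntervalD.mem ((smoothTaylorFDeriv (Ω := ⊤) hfOn d.K z).comp M (Pi.single l 1) i)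
        (IntervalD.aget NN ((e l : ℕ) * d.n + (e i : ℕ))) := by
    intro z hz M hM i l
    have hflat : (e l : ℕ) * d.n + (e i : ℕ) < d.n * d.n ∧ ((e l : ℕ) * d.n + (e i : ℕ)) / d.n = (e l : ℕ) ∧
        ((e l : ℕ) * d.n + (e i : ℕ)) % d.n = (e i : ℕ) :=
      ⟨by nlinarith [Nat.mul_le_mul_right d.n (Nat.succ_le_of_lt (e l).isLt), (e i).isLt],
        by rw [add_comm, Nat.add_mul_div_right _ _ (Nat.zero_lt_of_lt (e i).isLt), Nat.div_eq_of_lt (e i).isLt, zero_add],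
        by rw [add_comm, Nat.add_mul_mod_self_right, Nat.mod_eq_of_lt (e i).isLt]⟩
    obtain ⟨h1, h2, h3⟩ := hflat
    rw [hNN]
    unfold nnA
    rw [IntervalD.aget_ofFn _ h1]
    dsimp only
    rw [h2, h3, clm_comp_apply_single]
    unfold nn
    refine mem_sum_equiv e d.prec fun k hk => ?_
    refine IntervalD.mem_mulR d.prec ?_ ?_
    · have hm := hvarS z hz d.K le_rfl i (e.symm ⟨k, hk⟩)
      simp only [Equiv.apply_symm_apply] at hm
      rw [ePhi']
      exact hm
    · have hlo := hM.1 (e.symm ⟨k, hk⟩) l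
      have hhi := hM.2 (e.symm ⟨k, hk⟩) l
      simp only [hCV, hDV, Equiv.apply_symm_apply] at hlo hhi
      exact ⟨hlo, hhi⟩
  have hKN : ∀ z ∈ boxSet Sr, ∀ M : (ι → ℝ) →L[ℝ] (ι → ℝ), (fun i j => M (Pi.single j 1) i) ∈ Icc CV DV →
      (fun i j => (smoothTaylorFDeriv (Ω := ⊤) hfOn d.K z).comp M (Pi.single j 1) i) ∈ Icc CN DN := by
    intro z hz M hM
    exact ⟨fun i l => (hNNmem z hz M hM i l).1, fun i l => (hNNmem z hz M hM i l).2⟩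
  have hinclV : ∀ x ∈ boxSet Wr, ∀ t ∈ Icc 0 h, ∀ N : (ι → ℝ) →L[ℝ] (ι → ℝ),
      (fun i j => N (Pi.single j 1) i) ∈ Icc CN DN →
      (fun i j => ((∑ k ∈ Finset.range d.K, t ^ k • smoothTaylorFDeriv (Ω := ⊤) hfOn k x) + t ^ d.K • N)
        (Pi.single j 1) i) ∈ Icc CV DV := by
    intro x hx t ht N hN
    have hent : ∀ i l, IntervalD.mem (((∑ k ∈ Finset.range d.K, t ^ k • smoothTaylorFDeriv (Ω := ⊤) hfOn k x) +
        t ^ d.K • N) (Pi.single l 1) i) (d.vv (e i) (e l)) := by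
      intro i l
      refine IntervalD.mem_of_subset (hcM (e i) (e i).isLt (e l) (e l).isLt).2.2 ?_
      simp only [_root_.add_apply, _root_.sum_apply, _root_.smul_apply, Finset.sum_apply, Pi.smul_apply,
        Pi.add_apply, smul_eq_mul, ePhi']
      refine IntervalD.mem_addR d.prec (IntervalD.mem_rangeSumR d.prec d.K fun j hj => ?_) ?_
      · exact IntervalD.mem_mulR d.prec (d.mem_pows ht (le_of_lt hj)) (hvarW x hx j (le_of_lt hj) i l)
      · exact IntervalD.mem_mulR d.prec (d.mem_pows ht le_rfl) ⟨hN.1 i l, hN.2 i l⟩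
    exact ⟨fun i l => (hent i l).1, fun i l => (hent i l).2⟩
  have hSu : UniqueDiffOn ℝ (boxSet Sr) :=
    uniqueDiffOn_boxSet fun i => toNI_fst_lt_snd (hcS (e i) (e i).isLt).2.1
  -- (iii) the derivative within the box, for all `τ` (C¹ box) and at a time in `TI` (point-time Taylor form)
  have hmain : ∀ x ∈ boxSet Wr, ∀ τ ∈ Icc 0 h, ∃ J : (ι → ℝ) →L[ℝ] (ι → ℝ),
      HasFDerivWithinAt (fun x' => uc x' τ) J (boxSet Wr) x ∧ (fun i j => J (Pi.single j 1) i) ∈ Icc CV DV ∧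
      ∃ N : (ι → ℝ) →L[ℝ] (ι → ℝ), (fun i j => N (Pi.single j 1) i) ∈ Icc CN DN ∧
        J = (∑ j ∈ Finset.range d.K, τ ^ j • smoothTaylorFDeriv (Ω := ⊤) hfOn j x) + τ ^ d.K • N := fun x hx τ hτ =>
    hasFDerivWithinAt_flow_of_variationalEnclosure_smoothOn_local hfOn hK
      (S := boxSet Sr) (W := boxSet Wr) (fun _ _ => trivial) (isCompact_Icc) (convex_boxSet Sr) hSu hcd hKS hCDN
      hKN hh hincl hinclV hu hx hτ
  refine ⟨uc, hu, fun z hz0 hz t ht => (hC0 (z 0) hz0).2 z rfl hz t ht, fun x hx τ hτ => ?_, fun x hx τ hτ TI hTI => ?_⟩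
  · obtain ⟨J, hJ, hJenc, -⟩ := hmain x hx τ hτ
    exact ⟨J, hJ, fun i l => ⟨hJenc.1 i l, hJenc.2 i l⟩⟩
  · obtain ⟨J, hJ, -, N, hN, hJeq⟩ := hmain x hx τ hτ
    refine ⟨J, hJ, fun i l => ?_⟩
    have hflat : (e l : ℕ) * d.n + (e i : ℕ) < d.n * d.n :=
      by nlinarith [Nat.mul_le_mul_right d.n (Nat.succ_le_of_lt (e l).isLt), (e i).isLt]
    have hval : J (Pi.single l 1) i =
        (∑ j ∈ Finset.range d.K, τ ^ j * vjet T j x (Pi.single l 1) i) + τ ^ d.K * N (Pi.single l 1) i := by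
      rw [hJeq]
      simp only [_root_.add_apply, _root_.sum_apply, _root_.smul_apply, Finset.sum_apply, Pi.smul_apply,
        Pi.add_apply, smul_eq_mul, ePhi']
    rw [hval]
    unfold endMatI
    refine IntervalD.mem_addR d.prec (IntervalD.mem_rangeSumR d.prec d.K fun j hj => ?_) ?_
    · exact IntervalD.mem_mulR d.prec (IntervalD.mem_powR d.prec hTI j) (hvarW x hx j (le_of_lt hj) i l)
    · refine IntervalD.mem_mulR d.prec (IntervalD.mem_powR d.prec hTI d.K) ?_
      rw [← hNN]
      exact ⟨hN.1 i l, hN.2 i l⟩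

end Sound

end CentreStepD

end DSSOneShift

end Summit.NavierStokesRegularity.NavierStokesRegularity.Theorems
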